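import Summits.Ventures.HodgeRepro2.T5IsotypicStep4Adelic

/-!
# T5IsotypicStep4Product — STEP 4 for a product group `G = A × B`: (α) holds automatically

Cell pub-hodge-repro2, seat p5, Tier 5 (route/T5-N4-p5.md, N4.3 v13 (A3) STEP 4, l. 147).  Row 79
(`T5IsotypicStep4Adelic.existsUnique_le_isotypicPart`) proves «π₀ ⊂ L_{π_∞}» for a `ρ`-irreducible
`W₀` under the factorisation hypothesis `hgen` (every `g ∈ G` is `ι a * c` with `ρ c` commuting with
`ρ (ι a')`).  For the product `G = A × B` («G(𝔸) = G_∞ × G(𝔸_f)», the shape of the application) with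
`ι = inl`, the factorisation `(a, b) = (a, 1) * (1, b)` holds and `ρ (1, b)` commutes with
`ρ (a', 1)` because `ρ` is a homomorphism and the two factors commute in `A × B` — no hypothesis
at all:

* `hgen_prod`: the factorisation hypothesis of row 79 for `G = A × B`, `ι = MonoidHom.inl`;
* `isotypicPart_stable_prod`: (α) — every canonical `A`-isotypic part of `ρ ∘ inl` is `ρ`-stable;
* **`existsUnique_le_isotypicPart_prod`**: for `ρ : A × B →* (E →L[ℂ] E)` unitary, pairwise
  inequivalent irreducible unitary `σ π` of `A` whose canonical isotypic parts (for `ρ ∘ inl`) have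
  dense span, a closed `ρ`-stable `W₀ ≠ ⊥` irreducible under `ρ` lies in exactly one canonical
  isotypic part.

Imports row 79.  Axioms: propext, Classical.choice, Quot.sound.
README §8(d): uses an L-value-free non-vanishing device: NO.
-/

namespace Summit.Ventures.HodgeRepro2.T5IsotypicStep4Product

open Summit.Ventures.HodgeRepro2.T5IsotypicStep4Adelic (isotypicPart isotypicPart_stable
  existsUnique_le_isotypicPart)

variable {E : Type*} [NormedAddCommGroup E] [InnerProductSpace ℂ E] [CompleteSpace E]
variable {A B : Type*} [Group A] [Group B]

omit [CompleteSpace E] in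
/-- The factorisation hypothesis of row 79 holds for a product: `(a, b) = inl a * (1, b)` and
`ρ (1, b)` commutes with every `ρ (a', 1)`. -/
theorem hgen_prod (ρ : A × B →* (E →L[ℂ] E)) (g : A × B) :
    ∃ (a : A) (c : A × B), g = MonoidHom.inl A B a * c ∧
      ∀ a', ρ c * ρ (MonoidHom.inl A B a') = ρ (MonoidHom.inl A B a') * ρ c := by
  refine ⟨g.1, (1, g.2), ?_, fun a' => ?_⟩
  · ext <;> simp
  · rw [← map_mul, ← map_mul]
    congr 1
    ext <;> simp

/-- **(α) for a product group**: every canonical `A`-isotypic part of `ρ ∘ inl` is stable under the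
whole of `ρ`. -/
theorem isotypicPart_stable_prod {ρ : A × B →* (E →L[ℂ] E)} (hρ : ∀ g, star (ρ g) = ρ g⁻¹)
    {F : Type*} [NormedAddCommGroup F] [InnerProductSpace ℂ F] (σ : A →* (F →L[ℂ] F)) (g : A × B) :
    ∀ x ∈ isotypicPart (ρ.comp (MonoidHom.inl A B)) σ,
      ρ g x ∈ isotypicPart (ρ.comp (MonoidHom.inl A B)) σ :=
  isotypicPart_stable hρ (MonoidHom.inl A B) (hgen_prod ρ) σ g

section Assembled

variable {P : Type*} {F : P → Type*} [∀ π, NormedAddCommGroup (F π)]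
  [∀ π, InnerProductSpace ℂ (F π)] [∀ π, CompleteSpace (F π)]

/-- **(A3) STEP 4 for `G(𝔸) = G_∞ × G(𝔸_f)`, no factorisation hypothesis.**  `ρ` unitary on `E` for
the product `A × B`, `σ π` pairwise inequivalent irreducible unitary representations of `A`, the
canonical `A`-isotypic parts of `ρ ∘ inl` with dense span; a closed `ρ`-stable `W₀ ≠ ⊥` irreducible
under `ρ` lies in EXACTLY ONE canonical isotypic part: «π₀ ⊂ L_{π_∞}». -/
theorem existsUnique_le_isotypicPart_prod {ρ : A × B →* (E →L[ℂ] E)}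
    (hρ : ∀ g, star (ρ g) = ρ g⁻¹)
    (σ : ∀ π, A →* (F π →L[ℂ] F π)) (hσ : ∀ π a, star (σ π a) = σ π a⁻¹)
    (hσirr : ∀ π, ∀ V : Submodule ℂ (F π), IsClosed (V : Set (F π)) →
      (∀ a, ∀ v ∈ V, σ π a v ∈ V) → V = ⊥ ∨ V = ⊤)
    (hne : ∀ π π', π ≠ π' → ∀ V : F π ≃ₗᵢ[ℂ] F π', ¬ ∀ a x, V (σ π a x) = σ π' a (V x))
    (hdense : (⨆ π, isotypicPart (ρ.comp (MonoidHom.inl A B)) (σ π)).topologicalClosure = ⊤)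
    {W₀ : Submodule ℂ E} (hW₀c : IsClosed (W₀ : Set E)) (hW₀0 : W₀ ≠ ⊥)
    (ρW₀ : A × B →* (W₀ →L[ℂ] W₀)) (hρW₀ : ∀ g (w : W₀), (ρW₀ g w : E) = ρ g w)
    (hW₀irr : ∀ C : Submodule ℂ W₀, IsClosed (C : Set W₀) →
      (∀ g, ∀ x ∈ C, ρW₀ g x ∈ C) → C = ⊥ ∨ C = ⊤) :
    ∃! π, W₀ ≤ isotypicPart (ρ.comp (MonoidHom.inl A B)) (σ π) :=
  existsUnique_le_isotypicPart hρ (MonoidHom.inl A B) (hgen_prod ρ) σ hσ hσirr hne hdense hW₀c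
    hW₀0 ρW₀ hρW₀ hW₀irr

end Assembled

end Summit.Ventures.HodgeRepro2.T5IsotypicStep4Product
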